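import Summits.CriticalPhenomena.PercolationContinuityZ3.Theorems.SahiMasterFamilyGHConjecture
import Summits.CriticalPhenomena.PercolationContinuityZ3.Theorems.SahiMasterFamilyPhiVertex
import Summits.CriticalPhenomena.PercolationContinuityZ3.Theorems.SahiMasterFamilyPhiProduct

/-!
# The PATCHWORK decomposition of `Φ_n` on the union-closed hull and the Bernstein-positivity conjecture (B),
# which implies `(UC-hull)_n` and `(GH)_n` for every `n`; (B) for one family is the vertex theorem (V)

Unit `prim-masterthm-p4` (gen 21; crux anchor stmt-CriticalPhenomena-4575, helper work; memo
`run/shared/lean/prim/prim-masterthm/prim-masterthm-p4/P4-GEN21-REPORT.md` §3).  Companion of `…GHConjecture` (`UCHullNonneg`,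
`GSystemNonneg`, `(UC-hull)_k ⇒ (GH)_k`) and `…PhiVertex` ((V): `Φ ≥ 0` at every union-closed vertex).

PATCHWORK DECOMPOSITION (`phiSet_mixture_eq_sum_patchwork`, every `n`).  Let `β = Σ_x w_x 1_{𝒰_x}` be a finite mixture (`Σ w_x = 1`) of
families of subsets of `Fin (n+1)`.  Give every element `i` an independent label `ℓ(i) = x` with probability `w_x` and let the block `B` of a set
partition be tested against the family of the label of its LEAST element.  Since the blocks are disjoint their tests are independent, so
`Φ_{n+1}(β) = Σ_{ℓ : Fin (n+1) → α} (∏_i w_{ℓ(i)}) · Φ_{n+1}(1_{ℱ_ℓ})`,  `ℱ_ℓ := {S : S ∈ 𝒰_{ℓ(min S)}}` (the PATCHWORK family of the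
labelling `ℓ`).  Grouping the labellings by their type `j = (#ℓ⁻¹(x))_x` exhibits `Φ_{n+1}(Σ_x w_x 1_{𝒰_x})` as `Σ_j N_j · ∏_x w_x^{j_x}` with
INTEGER coefficients `N_j = Σ_{ℓ of type j} Φ_{n+1}(1_{ℱ_ℓ})` (`layerSum`) — the degree-`(n+1)` Bernstein coefficients of the mixture polynomial on
the simplex (up to multinomial factors; they do not depend on the choice "least element").
CONJECTURE (B) (`UCBernsteinNonneg`, typed, never a fact): for union-closed families `𝒰_x ∋ univ`, every `N_j ≥ 0`.  For a single family
(`α = Unit`) this is exactly the vertex theorem (V) (`layerSum_unit_nonneg`).  `ucHullNonneg_of_ucBernstein`: **(B)_n ⇒ (UC-hull)_n**, hence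
`gSystemNonneg_of_ucBernstein`: (B)_n ⇒ (GH)_n (= Sahi's `C_n` on the principal-cap stratum).  Evidence (memo §3, exact arithmetic): no negative
`N_j` among all pairs of union-closed families on 4 points (374 550 orbit-pairs), 20 000 random pairs on 5 points, 3 000 on 6, 400 on 7, random
3/4/5-tuples on 4–6 points, all pairs of 2-block-invariant families of shapes (2,2),(3,3) and the structured bi-glued / bi-principal / crossing pairs
up to 12 points — including the bi-glued mixtures at which the slot-uniform strengthening H♯ FAILS (k ≥ 8): there the Bernstein coefficients stay
within 21% of the vertex value.  A single patchwork functional `Φ(1_{ℱ_ℓ})` CAN be negative (ℱ_ℓ is only "min-graded" union-closed); only the layer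
sums are conjectured nonnegative.  HONEST FRAMING: a typed conjecture and a proved reduction; `UCHullNonneg n` (n ≥ 8), Sahi's `C_k`, Kahn's
Conjecture 5 and the master theorem remain OPEN.  Axioms standard. [this work]
-/

noncomputable section

open scoped Classical

namespace Summit.CriticalPhenomena.PercolationContinuityZ3.Theorems

namespace UCBernstein

open Finset Function
open Literature.Combinatorics.Sahi2008
open PrincipalCapBeta (phiSet)

variable {n : ℕ}

/-! ### Patchwork families of a labelling -/

/-- The PATCHWORK family of a labelling `ℓ`: a nonempty set `S` belongs to it iff `S` belongs to the family owned by the label of its least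
element (`∃ i ∈ S, i ≤ every element of S ∧ S ∈ 𝒰_{ℓ i}`; the least element is unique, so this is `S ∈ 𝒰_{ℓ(min S)}`). [this work] -/
def InPatch {α : Type} (𝒰 : α → Finset (Finset (Fin n))) (ℓ : Fin n → α) (S : Finset (Fin n)) : Prop :=
  ∃ i ∈ S, (∀ i' ∈ S, i ≤ i') ∧ S ∈ 𝒰 (ℓ i)

/-- The indicator of the patchwork family. [this work] -/
def patchInd {α : Type} (𝒰 : α → Finset (Finset (Fin n))) (ℓ : Fin n → α) (S : Finset (Fin n)) : ℝ :=
  if InPatch 𝒰 ℓ S then 1 else 0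

/-- The TYPE of a labelling: how many elements carry each label. [this work] -/
def ltype {α : Type} (ℓ : Fin n → α) : α → ℕ := fun x => (univ.filter fun i => ℓ i = x).card

/-- The LAYER SUM `N_j = Σ_{ℓ of type j} Φ_n(1_{ℱ_ℓ})`: the (unnormalised) degree-`n` Bernstein coefficient of index `j` of the mixture polynomial
`w ↦ Φ_n(Σ_x w_x 1_{𝒰_x})` on the simplex. [this work] -/
def layerSum {α : Type} [Fintype α] (𝒰 : α → Finset (Finset (Fin n))) (j : α → ℕ) : ℝ :=
  ∑ ℓ ∈ (univ : Finset (Fin n → α)).filter (fun ℓ => ltype ℓ = j), phiSet n (patchInd 𝒰 ℓ)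

/-- **CONJECTURE (B)** — Bernstein positivity of Sahi's functional on the union-closed polytope: for every finite family of union-closed
families `𝒰_x ∋ univ` of subsets of `Fin n` and every type `j`, the layer sum `N_j` is nonnegative.  For one family this is the vertex
theorem (V); numerically verified far beyond the range where H♯ fails (module docstring).  A conjecture-valued definition, never a fact.
[this work] [status: open; (B)_n ⇒ (UC-hull)_n] -/
@[conjecture] def UCBernsteinNonneg (n : ℕ) : Prop :=
  ∀ (α : Type) [Fintype α] (𝒰 : α → Finset (Finset (Fin n))),
    (∀ x, ∀ A ∈ 𝒰 x, ∀ A' ∈ 𝒰 x, A ∪ A' ∈ 𝒰 x) → (∀ x, univ ∈ 𝒰 x) → ∀ j : α → ℕ, 0 ≤ layerSum 𝒰 j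

/-! ### The least element of a block as its representative -/

/-- The representative (least element) of a set; junk value `0` on the empty set. [this work] -/
def rep (S : Finset (Fin (n + 1))) : Fin (n + 1) := if h : S.Nonempty then S.min' h else 0

/-- The representative of a nonempty set belongs to it. [this work] -/
theorem rep_mem {S : Finset (Fin (n + 1))} (h : S.Nonempty) : rep S ∈ S := by
  unfold rep; rw [dif_pos h]; exact min'_mem S h

/-- The representative of a nonempty set is its least element. [this work] -/
theorem rep_le {S : Finset (Fin (n + 1))} {i : Fin (n + 1)} (hi : i ∈ S) : rep S ≤ i := by
  unfold rep; rw [dif_pos ⟨i, hi⟩]; exact min'_le S i hi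

/-- For a nonempty set, membership in the patchwork family is membership in the family of the representative's label. [this work] -/
theorem inPatch_iff {α : Type} (𝒰 : α → Finset (Finset (Fin (n + 1)))) (ℓ : Fin (n + 1) → α) {S : Finset (Fin (n + 1))}
    (h : S.Nonempty) : InPatch 𝒰 ℓ S ↔ S ∈ 𝒰 (ℓ (rep S)) := by
  constructor
  · rintro ⟨i, hi, hmin, hS⟩
    have : rep S = i := le_antisymm (rep_le hi) (hmin _ (rep_mem h))
    rwa [this]
  · intro hS
    exact ⟨rep S, rep_mem h, fun i' hi' => rep_le hi', hS⟩

/-- For a nonempty set the patchwork indicator is the indicator of the representative's family. [this work] -/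
theorem patchInd_eq {α : Type} (𝒰 : α → Finset (Finset (Fin (n + 1)))) (ℓ : Fin (n + 1) → α) {S : Finset (Fin (n + 1))}
    (h : S.Nonempty) : patchInd 𝒰 ℓ S = if S ∈ 𝒰 (ℓ (rep S)) then (1 : ℝ) else 0 := by
  unfold patchInd
  by_cases hS : S ∈ 𝒰 (ℓ (rep S))
  · rw [if_pos hS, if_pos ((inPatch_iff 𝒰 ℓ h).2 hS)]
  · rw [if_neg hS, if_neg (fun h' => hS ((inPatch_iff 𝒰 ℓ h).1 h'))]

/-- Blocks of a set partition are nonempty. [folklore] -/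
theorem block_nonempty (c : OrderedFinpartition (n + 1)) (j : Fin c.length) : (PartitionForm.block c j).Nonempty := by
  rw [← Finset.card_pos, PartitionForm.card_block]
  exact c.partSize_pos j

/-- Every element lies in the block of its index. [folklore] -/
theorem mem_block_index (c : OrderedFinpartition (n + 1)) (i : Fin (n + 1)) : i ∈ PartitionForm.block c (c.index i) := by
  unfold PartitionForm.block
  exact mem_filter.2 ⟨mem_univ _, rfl⟩

/-! ### The patchwork decomposition -/

/-- **Key product identity.**  For a set partition `c` and functions `g_j : α → ℝ` attached to its blocks,
`Σ_{ℓ : Fin (n+1) → α} (∏_i w_{ℓ i}) · ∏_j g_j(ℓ(rep block_j)) = ∏_j (Σ_x w_x g_j(x))` whenever `Σ_x w_x = 1`: the labels of the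
non-representative elements integrate out. [this work] -/
theorem sum_labellings_prod_block {α : Type} [Fintype α] (w : α → ℝ) (hw1 : ∑ x, w x = 1)
    (c : OrderedFinpartition (n + 1)) (g : Fin c.length → α → ℝ) :
    ∑ ℓ : Fin (n + 1) → α, (∏ i, w (ℓ i)) * ∏ j, g j (ℓ (rep (PartitionForm.block c j))) =
      ∏ j, ∑ x, w x * g j x := by
  -- per-element factors: the representative of a block carries the block's test, the other elements carry `1`
  set F : Fin (n + 1) → α → ℝ := fun i x =>
    w x * (if i = rep (PartitionForm.block c (c.index i)) then g (c.index i) x else 1) with hF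
  -- regroup a product over elements as a product over blocks, keeping only representatives
  have regroup : ∀ (h : Fin (n + 1) → ℝ) (G : Fin c.length → ℝ),
      (∀ i, h i = if i = rep (PartitionForm.block c (c.index i)) then G (c.index i) else 1) →
      ∏ i, h i = ∏ j, G j := by
    intro h G hh
    rw [← Finset.prod_fiberwise_of_maps_to (s := (univ : Finset (Fin (n + 1)))) (t := (univ : Finset (Fin c.length)))
      (g := c.index) (fun i _ => mem_univ _) h]
    refine prod_congr rfl fun j _ => ?_
    have hfib : (univ.filter fun i : Fin (n + 1) => c.index i = j) = PartitionForm.block c j := by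
      unfold PartitionForm.block; rfl
    rw [hfib]
    have e : ∀ i ∈ PartitionForm.block c j, h i = if i = rep (PartitionForm.block c j) then G j else 1 := by
      intro i hi
      have hij : c.index i = j := by
        unfold PartitionForm.block at hi; exact (mem_filter.1 hi).2
      rw [hh i, hij]
    rw [prod_congr rfl e, prod_ite_eq' (PartitionForm.block c j) (rep (PartitionForm.block c j)) (fun _ => G j),
      if_pos (rep_mem (block_nonempty c j))]
  have lhs : ∀ ℓ : Fin (n + 1) → α, ∏ i, F i (ℓ i) = (∏ i, w (ℓ i)) * ∏ j, g j (ℓ (rep (PartitionForm.block c j))) := by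
    intro ℓ
    simp only [hF]
    rw [prod_mul_distrib]
    congr 1
    refine regroup (fun i => if i = rep (PartitionForm.block c (c.index i)) then g (c.index i) (ℓ i) else 1)
      (fun j => g j (ℓ (rep (PartitionForm.block c j)))) (fun i => ?_)
    by_cases hi : i = rep (PartitionForm.block c (c.index i))
    · rw [if_pos hi, if_pos hi]
      exact congrArg (g (c.index i)) (congrArg ℓ hi)
    · rw [if_neg hi, if_neg hi]
  have rhs : ∀ i, ∑ x, F i x = if i = rep (PartitionForm.block c (c.index i)) then ∑ x, w x * g (c.index i) x else 1 := by
    intro i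
    simp only [hF]
    by_cases hi : i = rep (PartitionForm.block c (c.index i))
    · simp only [if_pos hi]
    · simp only [if_neg hi, mul_one, hw1]
  calc ∑ ℓ : Fin (n + 1) → α, (∏ i, w (ℓ i)) * ∏ j, g j (ℓ (rep (PartitionForm.block c j)))
      = ∑ ℓ : Fin (n + 1) → α, ∏ i, F i (ℓ i) := sum_congr rfl fun ℓ _ => (lhs ℓ).symm
    _ = ∏ i, ∑ x, F i x := (Fintype.prod_sum (fun i x => F i x)).symm
    _ = ∏ j, ∑ x, w x * g j x := regroup _ _ rhs

/-- **PATCHWORK DECOMPOSITION (every order).**  For a finite mixture `β = Σ_x w_x 1_{𝒰_x}` (`Σ w_x = 1`) of arbitrary families of subsets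
of `Fin (n+1)`:  `Φ_{n+1}(β) = Σ_{ℓ : Fin (n+1) → α} (∏_i w_{ℓ i}) · Φ_{n+1}(1_{ℱ_ℓ})`, where `ℱ_ℓ = {S : S ∈ 𝒰_{ℓ(min S)}}` is the patchwork
family of the labelling `ℓ`. [this work] -/
theorem phiSet_mixture_eq_sum_patchwork {α : Type} [Fintype α] (w : α → ℝ) (hw1 : ∑ x, w x = 1)
    (𝒰 : α → Finset (Finset (Fin (n + 1)))) :
    phiSet (n + 1) (fun S => ∑ x, w x * (if S ∈ 𝒰 x then (1 : ℝ) else 0)) =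
      ∑ ℓ : Fin (n + 1) → α, (∏ i, w (ℓ i)) * phiSet (n + 1) (patchInd 𝒰 ℓ) := by
  unfold PrincipalCapBeta.phiSet
  simp only [mul_sum]
  rw [sum_comm]
  refine sum_congr rfl fun c _ => ?_
  -- the partition `c` is fixed; pull the sign out
  have e : ∀ ℓ : Fin (n + 1) → α,
      (∏ i, w (ℓ i)) * ((-1 : ℝ) ^ (c.length - 1) *
        ∏ j : Fin c.length, (((c.partSize j - 1).factorial : ℝ) * patchInd 𝒰 ℓ (PartitionForm.block c j))) =
      (-1 : ℝ) ^ (c.length - 1) * (∏ j : Fin c.length, ((c.partSize j - 1).factorial : ℝ)) *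
        ((∏ i, w (ℓ i)) * ∏ j : Fin c.length,
          (if PartitionForm.block c j ∈ 𝒰 (ℓ (rep (PartitionForm.block c j))) then (1 : ℝ) else 0)) := by
    intro ℓ
    have hp : ∏ j : Fin c.length, (((c.partSize j - 1).factorial : ℝ) * patchInd 𝒰 ℓ (PartitionForm.block c j)) =
        (∏ j : Fin c.length, ((c.partSize j - 1).factorial : ℝ)) *
          ∏ j : Fin c.length, (if PartitionForm.block c j ∈ 𝒰 (ℓ (rep (PartitionForm.block c j))) then (1 : ℝ) else 0) := by
      rw [← prod_mul_distrib]
      refine prod_congr rfl fun j _ => ?_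
      rw [patchInd_eq 𝒰 ℓ (block_nonempty c j)]
    rw [hp]; ring
  rw [sum_congr rfl fun ℓ _ => e ℓ, ← mul_sum,
    sum_labellings_prod_block w hw1 c (fun j x => if PartitionForm.block c j ∈ 𝒰 x then (1 : ℝ) else 0),
    mul_assoc, ← prod_mul_distrib]
  congr 1
  refine prod_congr rfl fun j _ => ?_
  rw [mul_sum]

/-! ### (B) ⇒ (UC-hull) ⇒ (GH) -/

/-- The weight of a labelling depends only on its type: `∏_i w_{ℓ i} = ∏_x w_x^{j_x}`. [this work] -/
theorem prod_label_eq_prod_pow {α : Type} [Fintype α] (w : α → ℝ) (ℓ : Fin n → α) :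
    ∏ i, w (ℓ i) = ∏ x, w x ^ (ltype ℓ x) := by
  rw [← Finset.prod_fiberwise_of_maps_to (s := (univ : Finset (Fin n))) (t := (univ : Finset α)) (g := ℓ)
    (fun i _ => mem_univ _) (fun i => w (ℓ i))]
  refine prod_congr rfl fun x _ => ?_
  rw [prod_congr rfl (fun i hi => by rw [(mem_filter.1 hi).2] : ∀ i ∈ univ.filter (fun i => ℓ i = x), w (ℓ i) = w x),
    prod_const]
  rfl

/-- **(B)_{n+1} ⇒ (UC-hull)_{n+1}.**  By the patchwork decomposition, `Φ_{n+1}(Σ_x w_x 1_{𝒰_x}) = Σ_j (∏_x w_x^{j_x}) · N_j ≥ 0`. [this work] -/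
theorem ucHullNonneg_succ_of_ucBernstein (h : UCBernsteinNonneg (n + 1)) : GHConjecture.UCHullNonneg (n + 1) := by
  intro α _ w 𝒰 hw0 hw1 hUC htop
  rw [phiSet_mixture_eq_sum_patchwork w hw1 𝒰]
  -- group the labellings by type
  rw [← Finset.sum_fiberwise_of_maps_to (s := (univ : Finset (Fin (n + 1) → α)))
    (t := (univ : Finset (Fin (n + 1) → α)).image ltype) (g := ltype) (fun ℓ _ => mem_image_of_mem _ (mem_univ ℓ))]
  refine sum_nonneg fun j _ => ?_
  have e : ∀ ℓ ∈ (univ : Finset (Fin (n + 1) → α)).filter (fun ℓ => ltype ℓ = j),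
      (∏ i, w (ℓ i)) * phiSet (n + 1) (patchInd 𝒰 ℓ) = (∏ x, w x ^ j x) * phiSet (n + 1) (patchInd 𝒰 ℓ) := by
    intro ℓ hℓ
    rw [prod_label_eq_prod_pow, (mem_filter.1 hℓ).2]
  rw [sum_congr rfl e, ← mul_sum]
  exact mul_nonneg (prod_nonneg fun x _ => pow_nonneg (hw0 x) _) (h α 𝒰 hUC htop j)

/-- At `n = 0` the union-closed-hull statement holds outright (`Φ_0 ≥ 0`). [this work] -/
theorem ucHullNonneg_zero : GHConjecture.UCHullNonneg 0 :=
  fun _ _ _ _ _ _ _ _ => PhiProduct.phiSet_zero_nonneg _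

/-- **(B)_n ⇒ (UC-hull)_n** for every `n`. [this work] -/
theorem ucHullNonneg_of_ucBernstein (h : UCBernsteinNonneg n) : GHConjecture.UCHullNonneg n := by
  cases n with
  | zero => exact ucHullNonneg_zero
  | succ n => exact ucHullNonneg_succ_of_ucBernstein h

/-- **(B)_n ⇒ (GH)_n** (= Sahi's `C_n` on the principal-cap stratum), every `n`. [this work] -/
theorem gSystemNonneg_of_ucBernstein (h : UCBernsteinNonneg n) : GHConjecture.GSystemNonneg n :=
  GHConjecture.gSystemNonneg_of_ucHullNonneg (ucHullNonneg_of_ucBernstein h)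

/-! ### (B) for a single family is the vertex theorem (V) -/

/-- With one family every labelling is constant and the patchwork family is the family itself. [this work] -/
theorem patchInd_unit (𝒰 : Unit → Finset (Finset (Fin (n + 1)))) (ℓ : Fin (n + 1) → Unit) (S : Finset (Fin (n + 1)))
    (hS : S.Nonempty) : patchInd 𝒰 ℓ S = if S ∈ 𝒰 () then (1 : ℝ) else 0 := by
  rw [patchInd_eq 𝒰 ℓ hS]

/-- **(B) for one family = (V).**  Every layer sum of a single union-closed family `𝒰 ∋ univ` is `≥ 0` (it is `Φ_{n+1}(1_𝒰)` or an empty sum).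
[this work] -/
theorem layerSum_unit_nonneg (𝒰 : Unit → Finset (Finset (Fin (n + 1))))
    (hUC : ∀ x, ∀ A ∈ 𝒰 x, ∀ A' ∈ 𝒰 x, A ∪ A' ∈ 𝒰 x) (htop : ∀ x, univ ∈ 𝒰 x) (j : Unit → ℕ) : 0 ≤ layerSum 𝒰 j := by
  unfold layerSum
  refine sum_nonneg fun ℓ _ => ?_
  have e : phiSet (n + 1) (patchInd 𝒰 ℓ) = phiSet (n + 1) (fun S => if S ∈ 𝒰 () then (1 : ℝ) else 0) := by
    unfold PrincipalCapBeta.phiSet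
    refine sum_congr rfl fun c _ => ?_
    congr 1
    refine prod_congr rfl fun i _ => ?_
    rw [patchInd_unit 𝒰 ℓ _ (block_nonempty c i)]
  rw [e]
  exact PhiVertex.phiSet_indicator_nonneg_of_unionClosed (Nat.succ_le_succ (Nat.zero_le n)) (𝒰 ()) (hUC ()) (htop ())

end UCBernstein

end Summit.CriticalPhenomena.PercolationContinuityZ3.Theorems
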